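import Summits.AnomalousDissipation.AnomalousDissipation.Theses.MomentParity
import Summits.AnomalousDissipation.AnomalousDissipation.Theorems.QuarticGate.Negative.EnergyRow
import Summits.AnomalousDissipation.AnomalousDissipation.Theorems.ResolvedDissipation.Negative.KillShape
import Summits.AnomalousDissipation.AnomalousDissipation.Theorems.MomentParityResolvedDissipationStubTightExtraction
import Summits.AnomalousDissipation.AnomalousDissipation.Theorems.MomentParityResolvedDissipationStubLimitSSS
import Summits.AnomalousDissipation.AnomalousDissipation.Theorems.MomentParityResolvedDissipationStubSchedule
import Literature.Analysis.FluidPDE.StatisticalSolutionEnergyEq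
import Literature.Analysis.FluidPDE.EnergySpaceRellich

/-!
# Route MomentParity · crux `ResolvedDissipation` (stmt-AnomalousDissipation-14284) —
# the docstring's "Equivalently": resolution ⟺ mean energy EQUALITY of Galerkin-limit stationary
# statistical solutions (with approximants in a common ball)

Supports stmt-AnomalousDissipation-14284 (line `lions-l4-domination`; no route-item statement is
asserted — the crux stays open both ways).

Fix `ν > 0`, `f ∈ L²(T³; ℝ³)` and a radius `R`. A law `μ` on `H = L²_σ(T³)` is ADMISSIBLE at level `N`
if it is a probability measure carried by level-`N` Fourier–Galerkin fields (`IsLevel N` a.e.), supported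
in the ball `‖u‖ ≤ R`, and stationary at every order for Galerkin NS at `(ν, f)`
(`∀ d, IsPolyStationary ν f N d μ`). The crux asks, at each `(f, ν, R)`, for ONE cutoff schedule `κ`
with `∫‖∇u‖² dμ ≤ ∫‖∇P_{κ n}u‖² dμ + 1/(n+1)` for every admissible `(N, μ)` and every `n`
("RESOLVED at `(f, ν, R)`"). Its docstring adds: "Equivalently (up to subsequences): weak limits
`N → ∞` of such invariant families — Vishik–Fursikov/FMRT stationary statistical solutions — satisfy
the mean energy EQUALITY `ν⟨‖∇u‖²⟩ = ⟨(f,u)⟩` rather than FMRT's inequality (IV (1.31))". This file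
makes that sentence a theorem, over the infrastructure of the line `lions-l4-domination`
(K2a `TightExtraction.stub_tightExtraction`: Rellich–Prokhorov extraction on `H` with the lsc
portmanteau; K2b `LimitSSS.stub_limitIsStationarySolution`: such limits ARE stationary statistical
solutions in the tree's sense, FMRT IV Def. 1.3; K2c `Schedule.stub_scheduleOfLimitEnergyEq`: energy
equality of all limits ⇒ one schedule):

* `limitEnergyEq_of_resolved` (⇒, the new half): if `(f, ν, R)` is resolved by `κ`, then along ANY
  sequence of admissible laws converging to a law `μ_∞` in the weak sense used by K2a (injections
  `∫(u,f)` and every truncated mean enstrophy `∫‖∇P_K u‖²` converge, and `∫‖∇u‖² dμ_∞ ≤ liminf`) there is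
  NO ENSTROPHY LOSS — `∫‖∇u‖² dμ_i → ∫‖∇u‖² dμ_∞ < ∞` — and `μ_∞` satisfies the mean energy EQUALITY
  `ν ∫‖∇u‖² dμ_∞ = ∫ (u,f) dμ_∞`. (Energy rows `ν e(μ_i) = ∫(u,f)dμ_i` converge to `∫(u,f)dμ_∞`; lsc gives
  `ν e(μ_∞) ≤ ∫(u,f)dμ_∞`; resolution gives `e(μ_i) ≤ e_{κ n}(μ_i) + 1/(n+1) → e_{κ n}(μ_∞) + 1/(n+1) ≤
  e(μ_∞) + 1/(n+1)` for every `n`.)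
* `resolvedAt_iff_galerkinLimitEnergyEq` (⟺ at fixed `(f, ν, R)`): resolved ⟺ every admissible sequence
  at levels `N_i → ∞` has a subsequence converging (injections and truncated enstrophies) to a
  stationary statistical solution `μ_∞` of NS at `(ν, f)`, carried by the ball, with finite mean
  enstrophy and the mean energy EQUALITY. (⇒: K2a extracts, K2b identifies the limit, the first theorem
  gives the equality; ⇐: K2c.)
* `resolvedDissipation_iff_galerkinLimitEnergyEq`: the crux `ResolvedDissipation` ⟺ the same for every
  smooth divergence-free mean-zero `f`, every `ν > 0` and every `R` — the registered statement.

So the crux is EXACTLY the 3-D mean energy equality for Galerkin-limit stationary statistical solutions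
whose approximants live in a common ball (known in 3-D only as the inequality FMRT IV (1.31); proved in
tree for `d = 2`, `IsStationaryStatisticalSolution.energy_eq_holds`; `WhyItResists.md`: its failure means
statistically persistent finite-time blow-up of forced 3-D NS on `T³`).

References: Foias–Manley–Rosa–Temam, *Navier–Stokes Equations and Turbulence* (2001), Ch. IV Def. 1.3,
(1.29)–(1.31), Ch. V (Vishik–Fursikov measures); Foias–Rosa–Temam, J. Dyn. Diff. Eq. 31 (2019)
(arXiv:1606.02174) §4 Def. 4.1, Rem. 4.1.
-/

noncomputable section

-- `Summit.<Summit>.<Problem>`: single-conjunct summit, the duplicate namespace segment is mandated.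
set_option linter.dupNamespace false

namespace Summit.AnomalousDissipation.AnomalousDissipation.Theorems.MomentParityResolvedDissipation.Equivalently

open MeasureTheory Filter Topology
open scoped ENNReal NNReal InnerProductSpace RealInnerProductSpace
open Literature.Analysis.FunctionSpaces Literature.Analysis.FluidPDE
open Summit.AnomalousDissipation.AnomalousDissipation.Theses.MomentParity
open Summit.AnomalousDissipation.AnomalousDissipation.Theorems.QuarticGate.Negative

/-! ## ⇒ : resolution ⇒ no enstrophy loss and the mean energy equality in every limit -/

/-- **Resolution ⇒ no enstrophy loss ⇒ mean energy EQUALITY of the limit.** Fix `ν > 0`, `f ∈ L²`,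
`R` and a schedule `κ` resolving every admissible law at `(f, ν, R)`. Let `μ_i` be admissible laws (any
levels `N_i`) and `μ_∞` a measure on `H` such that the injections `∫ (u,f) dμ_i → ∫ (u,f) dμ_∞`, every
truncated mean enstrophy `∫ ‖∇P_K u‖² dμ_i → ∫ ‖∇P_K u‖² dμ_∞`, and `∫ ‖∇u‖² dμ_∞ ≤ liminf ∫ ‖∇u‖² dμ_i`
(the three convergence clauses K2a's extraction provides). Then the mean enstrophy of `μ_∞` is finite,
`ν ∫ ‖∇u‖² dμ_∞ = ∫ (u,f) dμ_∞`, and `∫ ‖∇u‖² dμ_i → ∫ ‖∇u‖² dμ_∞` (no enstrophy is lost in the limit).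
[folklore; FMRT 2001 Ch. IV (1.31) is the inequality half] -/
theorem limitEnergyEq_of_resolved {ν : ℝ} (hν : 0 < ν)
    {f : UnitAddTorus (Fin 3) → EuclideanSpace ℝ (Fin 3)} (hf : MemLp f 2 volume) {R : ℝ} {κ : ℕ → ℕ}
    (hres : ∀ (N : ℕ) (μ : Measure (Torus.energySpace (Fin 3))), IsProbabilityMeasure μ →
      (∀ᵐ u ∂μ, IsLevel N u) → (∀ᵐ u ∂μ, ‖u‖ ≤ R) → (∀ d : ℕ, IsPolyStationary ν f N d μ) →
      ∀ n : ℕ, ∫⁻ u, Torus.eGradNormSq (u.1 : UnitAddTorus (Fin 3) → EuclideanSpace ℝ (Fin 3)) ∂μ ≤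
        (∫⁻ u, Torus.eGradNormSq (Torus.fourierTruncate (κ n)
          (u.1 : UnitAddTorus (Fin 3) → EuclideanSpace ℝ (Fin 3))) ∂μ) + ((n : ℝ≥0∞) + 1)⁻¹)
    {Nl : ℕ → ℕ} {μ : ℕ → Measure (Torus.energySpace (Fin 3))}
    (hp : ∀ i, IsProbabilityMeasure (μ i)) (hl : ∀ i, ∀ᵐ u ∂(μ i), IsLevel (Nl i) u)
    (hb : ∀ i, ∀ᵐ u ∂(μ i), ‖u‖ ≤ R) (hs : ∀ i (d : ℕ), IsPolyStationary ν f (Nl i) d (μ i))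
    {μlim : Measure (Torus.energySpace (Fin 3))}
    (hP : Tendsto (fun i => ∫ u, Torus.pairing u.1 f ∂(μ i)) atTop (𝓝 (∫ u, Torus.pairing u.1 f ∂μlim)))
    (hT : ∀ K : ℕ, Tendsto (fun i => ∫⁻ u, Torus.eGradNormSq (Torus.fourierTruncate K
        (u.1 : UnitAddTorus (Fin 3) → EuclideanSpace ℝ (Fin 3))) ∂(μ i)) atTop
      (𝓝 (∫⁻ u, Torus.eGradNormSq (Torus.fourierTruncate K
        (u.1 : UnitAddTorus (Fin 3) → EuclideanSpace ℝ (Fin 3))) ∂μlim)))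
    (hL : Torus.ensembleEnstrophy μlim ≤
      Filter.liminf (fun i => Torus.ensembleEnstrophy (μ i)) atTop) :
    Torus.ensembleEnstrophy μlim ≠ ⊤ ∧
      ν * (Torus.ensembleEnstrophy μlim).toReal = ∫ u, Torus.pairing u.1 f ∂μlim ∧
      Tendsto (fun i => Torus.ensembleEnstrophy (μ i)) atTop (𝓝 (Torus.ensembleEnstrophy μlim)) := by
  -- energy row at each level: `E_i = ofReal (∫ (u,f) dμ_i / ν)`
  have hrow : ∀ i, Torus.ensembleEnstrophy (μ i) =
      ENNReal.ofReal ((∫ u, Torus.pairing u.1 f ∂(μ i)) / ν) := fun i => by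
    haveI := hp i
    exact Schedule.ensembleEnstrophy_eq_ofReal hν hf (hl i) (hb i) (hs i)
  set L : ℝ≥0∞ := ENNReal.ofReal ((∫ u, Torus.pairing u.1 f ∂μlim) / ν) with hL_def
  -- the mean enstrophies converge to `L`
  have hE : Tendsto (fun i => Torus.ensembleEnstrophy (μ i)) atTop (𝓝 L) := by
    simp_rw [hrow]
    exact (ENNReal.continuous_ofReal.tendsto _).comp (hP.div_const ν)
  -- the injections are nonnegative in the limit
  have hP0 : 0 ≤ (∫ u, Torus.pairing u.1 f ∂μlim) / ν := by
    refine ge_of_tendsto' (hP.div_const ν) fun i => ?_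
    have h : 0 ≤ (Torus.ensembleEnstrophy (μ i)).toReal := ENNReal.toReal_nonneg
    haveI := hp i
    have h2 : Integrable (fun u : Torus.energySpace (Fin 3) => ‖u‖ ^ 2) (μ i) :=
      Integrable.of_bound (continuous_norm.pow 2).aestronglyMeasurable (R ^ 2) ((hb i).mono
        fun u hu => by
          rw [Real.norm_eq_abs, abs_of_nonneg (by positivity)]
          exact pow_le_pow_left₀ (norm_nonneg _) hu 2)
    have hrowi := ensembleDissipation_eq_of_polyStationary f hf (hl i) h2 le_rfl (hs i 3)
    unfold Torus.ensembleDissipation at hrowi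
    rw [← hrowi]
    exact div_nonneg (mul_nonneg hν.le h) hν.le
  -- (a) lsc: `e(μ_∞) ≤ liminf e(μ_i) = L`
  have ha : Torus.ensembleEnstrophy μlim ≤ L := hL.trans_eq hE.liminf_eq
  -- (b) resolution: `L ≤ e(μ_∞) + 1/(n+1)` for every `n`
  have hb' : ∀ n : ℕ, L ≤ Torus.ensembleEnstrophy μlim + ((n : ℝ≥0∞) + 1)⁻¹ := by
    intro n
    have h1 : Tendsto (fun i => (∫⁻ u, Torus.eGradNormSq (Torus.fourierTruncate (κ n)
        (u.1 : UnitAddTorus (Fin 3) → EuclideanSpace ℝ (Fin 3))) ∂(μ i)) + ((n : ℝ≥0∞) + 1)⁻¹)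
        atTop (𝓝 ((∫⁻ u, Torus.eGradNormSq (Torus.fourierTruncate (κ n)
        (u.1 : UnitAddTorus (Fin 3) → EuclideanSpace ℝ (Fin 3))) ∂μlim) + ((n : ℝ≥0∞) + 1)⁻¹)) :=
      (hT (κ n)).add tendsto_const_nhds
    have h2 : L ≤ (∫⁻ u, Torus.eGradNormSq (Torus.fourierTruncate (κ n)
        (u.1 : UnitAddTorus (Fin 3) → EuclideanSpace ℝ (Fin 3))) ∂μlim) + ((n : ℝ≥0∞) + 1)⁻¹ :=
      le_of_tendsto_of_tendsto' hE h1 fun i => hres (Nl i) (μ i) (hp i) (hl i) (hb i) (hs i) n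
    refine h2.trans ?_
    gcongr
    unfold Torus.ensembleEnstrophy
    exact lintegral_mono fun u =>
      Torus.eGradNormSq_fourierTruncate_le ((Lp.memLp u.1).integrable one_le_two) (κ n)
  have hb : L ≤ Torus.ensembleEnstrophy μlim := by
    refine le_of_forall_pos_le_add fun ε hε => ?_
    obtain ⟨n, hn⟩ := ENNReal.exists_inv_nat_lt hε.ne'
    calc L ≤ Torus.ensembleEnstrophy μlim + ((n : ℝ≥0∞) + 1)⁻¹ := hb' n
      _ ≤ Torus.ensembleEnstrophy μlim + ε := by
          gcongr
          refine (ENNReal.inv_le_inv.2 ?_).trans hn.le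
          exact le_self_add
  have heq : Torus.ensembleEnstrophy μlim = L := le_antisymm ha hb
  refine ⟨heq ▸ ENNReal.ofReal_ne_top, ?_, heq ▸ hE⟩
  rw [heq, hL_def, ENNReal.toReal_ofReal hP0, mul_div_cancel₀ _ hν.ne']

/-! ## ⟺ at fixed `(f, ν, R)` -/

/-- **Resolved at `(f, ν, R)` ⟺ mean energy equality of every Galerkin limit.** For `ν > 0`, `f ∈ L²` and
a radius `R`, the following are equivalent: (i) ONE schedule `κ` resolves the mean enstrophy of every
admissible law (probability, level-`N` carried, in the ball `‖u‖ ≤ R`, stationary at all orders for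
Galerkin NS at `(ν, f)`) at every level; (ii) every sequence of admissible laws at levels `N_i → ∞` has a
subsequence along which the injections `∫ (u,f)` and all truncated mean enstrophies `∫ ‖∇P_K u‖²`
converge to those of a stationary statistical solution `μ_∞` of NS at `(ν, f)` (FMRT IV Def. 1.3, the
tree's `Torus.IsStationaryStatisticalSolution`), carried by the ball, with finite mean enstrophy and the
mean energy EQUALITY `ν ∫ ‖∇u‖² dμ_∞ = ∫ (u,f) dμ_∞`. (⇒: Rellich–Prokhorov extraction K2a, limits are
stationary statistical solutions K2b, `limitEnergyEq_of_resolved`; ⇐: the leak contradiction K2c.)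
[folklore; FMRT 2001 Ch. IV (1.31)] -/
theorem resolvedAt_iff_galerkinLimitEnergyEq {ν : ℝ} (hν : 0 < ν)
    {f : UnitAddTorus (Fin 3) → EuclideanSpace ℝ (Fin 3)} (hf : MemLp f 2 volume) (R : ℝ) :
    (∃ κ : ℕ → ℕ, ∀ (N : ℕ) (μ : Measure (Torus.energySpace (Fin 3))), IsProbabilityMeasure μ →
      (∀ᵐ u ∂μ, IsLevel N u) → (∀ᵐ u ∂μ, ‖u‖ ≤ R) → (∀ d : ℕ, IsPolyStationary ν f N d μ) →
      ∀ n : ℕ, ∫⁻ u, Torus.eGradNormSq (u.1 : UnitAddTorus (Fin 3) → EuclideanSpace ℝ (Fin 3)) ∂μ ≤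
        (∫⁻ u, Torus.eGradNormSq (Torus.fourierTruncate (κ n)
          (u.1 : UnitAddTorus (Fin 3) → EuclideanSpace ℝ (Fin 3))) ∂μ) + ((n : ℝ≥0∞) + 1)⁻¹) ↔
    (∀ (Nl : ℕ → ℕ) (μ : ℕ → Measure (Torus.energySpace (Fin 3))),
      (∀ i, IsProbabilityMeasure (μ i)) → (∀ i, ∀ᵐ u ∂(μ i), IsLevel (Nl i) u) →
      (∀ i, ∀ᵐ u ∂(μ i), ‖u‖ ≤ R) → (∀ i (d : ℕ), IsPolyStationary ν f (Nl i) d (μ i)) →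
      Tendsto Nl atTop atTop →
      ∃ φ : ℕ → ℕ, StrictMono φ ∧ ∃ μlim : Measure (Torus.energySpace (Fin 3)),
        Torus.IsStationaryStatisticalSolution ν f μlim ∧ (∀ᵐ u ∂μlim, ‖u‖ ≤ R) ∧
        Torus.ensembleEnstrophy μlim ≠ ⊤ ∧
        ν * (Torus.ensembleEnstrophy μlim).toReal = ∫ u, Torus.pairing u.1 f ∂μlim ∧
        Tendsto (fun i => ∫ u, Torus.pairing u.1 f ∂(μ (φ i))) atTop
          (𝓝 (∫ u, Torus.pairing u.1 f ∂μlim)) ∧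
        (∀ K : ℕ, Tendsto (fun i => ∫⁻ u, Torus.eGradNormSq (Torus.fourierTruncate K
            (u.1 : UnitAddTorus (Fin 3) → EuclideanSpace ℝ (Fin 3))) ∂(μ (φ i))) atTop
          (𝓝 (∫⁻ u, Torus.eGradNormSq (Torus.fourierTruncate K
            (u.1 : UnitAddTorus (Fin 3) → EuclideanSpace ℝ (Fin 3))) ∂μlim)))) := by
  constructor
  · rintro ⟨κ, hκ⟩ Nl μ hp hl hb hs hN
    -- the `N`-uniform enstrophy budget of admissible laws
    set M : ℝ≥0 := (Real.sqrt (∫ x, ‖f x‖ ^ 2) * R / ν).toNNReal with hM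
    have hbudget : ∀ i, Torus.ensembleEnstrophy (μ i) ≤ M := by
      intro i
      haveI := hp i
      haveI : (ae (μ i)).NeBot := ae_neBot.2 (IsProbabilityMeasure.ne_zero (μ i))
      obtain ⟨u₀, hu₀⟩ := (hb i).exists
      have hR0 : 0 ≤ R := (norm_nonneg _).trans hu₀
      have h := Theorems.ResolvedDissipation.Negative.ensembleEnstrophy_le_of_isStationary hν hf (hl i)
        hR0 (hb i) (fun m g P hg => hs i (P.totalDegree + 1) m g P hg le_rfl)
      rw [hM, ENNReal.ofReal] at *
      exact h
    obtain ⟨φ, hφ, μlim, hplim, hblim, hBC, hLSC, hTE, hPI⟩ :=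
      TightExtraction.stub_tightExtraction R M μ hp hb hbudget
    have hSSS : Torus.IsStationaryStatisticalSolution ν f μlim :=
      LimitSSS.stub_limitIsStationarySolution ν f R hν hf (fun i => Nl (φ i)) (fun i => μ (φ i))
        (fun i => hp (φ i)) (fun i => hl (φ i)) (fun i => hb (φ i)) (fun i d => hs (φ i) d)
        (hN.comp hφ.tendsto_atTop) μlim hplim hblim hBC hLSC
    have hL : Torus.ensembleEnstrophy μlim ≤
        Filter.liminf (fun i => Torus.ensembleEnstrophy (μ (φ i))) atTop :=
      hLSC _ Torus.lowerSemicontinuous_eGradNormSq_coe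
    obtain ⟨hfin, heq, -⟩ := limitEnergyEq_of_resolved hν hf hκ (fun i => hp (φ i))
      (fun i => hl (φ i)) (fun i => hb (φ i)) (fun i d => hs (φ i) d) (hPI f hf) hTE hL
    exact ⟨φ, hφ, μlim, hSSS, hblim, hfin, heq, hPI f hf, hTE⟩
  · intro h
    exact Schedule.stub_scheduleOfLimitEnergyEq ν f R hν hf fun Nl μ hp hl hb hs hN => by
      obtain ⟨φ, hφ, μlim, -, -, hfin, heq, hP, hT⟩ := h Nl μ hp hl hb hs hN
      exact ⟨φ, hφ, μlim, hfin, heq, hP, hT⟩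

/-! ## The crux ⟺ mean energy equality of Galerkin-limit stationary statistical solutions -/

/-- **`ResolvedDissipation` ⟺ the 3-D mean energy EQUALITY for Galerkin-limit stationary statistical
solutions with approximants in a common ball** (the crux docstring's "Equivalently", certified). The
crux holds iff for every smooth divergence-free mean-zero force `f`, every `ν > 0` and every radius `R`:
every sequence of admissible laws (probability, level-`N_i` carried, in the ball `‖u‖ ≤ R`, stationary at
all orders for Galerkin NS at `(ν, f)`) at levels `N_i → ∞` has a subsequence along which the injections
`∫ (u,f)` and all truncated mean enstrophies `∫ ‖∇P_K u‖²` converge to those of a stationary statistical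
solution `μ_∞` of NS at `(ν, f)` (`Torus.IsStationaryStatisticalSolution`, FMRT IV Def. 1.3 incl. the
shell energy inequality (1.31)), carried by the ball, with finite mean enstrophy and
`ν ∫ ‖∇u‖² dμ_∞ = ∫ (u,f) dμ_∞` — equality where the 3-D theory only has `≤`. The crux is neither proved
nor refuted here. [folklore; FMRT 2001 Ch. IV Def. 1.3 (1.29)–(1.31); arXiv:1606.02174 §4] -/
theorem resolvedDissipation_iff_galerkinLimitEnergyEq :
    ResolvedDissipation ↔
    ∀ f : UnitAddTorus (Fin 3) → EuclideanSpace ℝ (Fin 3),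
      Torus.IsSmooth f → Torus.IsDivFree f → Torus.HasZeroMean f → ∀ ν : ℝ, 0 < ν → ∀ R : ℝ,
    ∀ (Nl : ℕ → ℕ) (μ : ℕ → Measure (Torus.energySpace (Fin 3))),
      (∀ i, IsProbabilityMeasure (μ i)) → (∀ i, ∀ᵐ u ∂(μ i), IsLevel (Nl i) u) →
      (∀ i, ∀ᵐ u ∂(μ i), ‖u‖ ≤ R) → (∀ i (d : ℕ), IsPolyStationary ν f (Nl i) d (μ i)) →
      Tendsto Nl atTop atTop →
      ∃ φ : ℕ → ℕ, StrictMono φ ∧ ∃ μlim : Measure (Torus.energySpace (Fin 3)),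
        Torus.IsStationaryStatisticalSolution ν f μlim ∧ (∀ᵐ u ∂μlim, ‖u‖ ≤ R) ∧
        Torus.ensembleEnstrophy μlim ≠ ⊤ ∧
        ν * (Torus.ensembleEnstrophy μlim).toReal = ∫ u, Torus.pairing u.1 f ∂μlim ∧
        Tendsto (fun i => ∫ u, Torus.pairing u.1 f ∂(μ (φ i))) atTop
          (𝓝 (∫ u, Torus.pairing u.1 f ∂μlim)) ∧
        (∀ K : ℕ, Tendsto (fun i => ∫⁻ u, Torus.eGradNormSq (Torus.fourierTruncate K
            (u.1 : UnitAddTorus (Fin 3) → EuclideanSpace ℝ (Fin 3))) ∂(μ (φ i))) atTop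
          (𝓝 (∫⁻ u, Torus.eGradNormSq (Torus.fourierTruncate K
            (u.1 : UnitAddTorus (Fin 3) → EuclideanSpace ℝ (Fin 3))) ∂μlim))) := by
  constructor
  · intro h f hf hdiv hzero ν hν R
    obtain ⟨κ, hκ⟩ := h f hf hdiv hzero ν hν R
    exact (resolvedAt_iff_galerkinLimitEnergyEq hν (hf.memLp 2) R).1
      ⟨κ, fun N μ hp hl hb hs n => hκ N μ hp hl hb (fun m g P hg => hs (P.totalDegree + 1) m g P hg le_rfl) n⟩
  · intro h f hf hdiv hzero ν hν R
    obtain ⟨κ, hκ⟩ := (resolvedAt_iff_galerkinLimitEnergyEq hν (hf.memLp 2) R).2 (h f hf hdiv hzero ν hν R)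
    exact ⟨κ, fun N μ hp hl hb hs n => hκ N μ hp hl hb (fun d m g P hg _ => hs m g P hg) n⟩

end Summit.AnomalousDissipation.AnomalousDissipation.Theorems.MomentParityResolvedDissipation.Equivalently

end
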